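import Summits.MatrixMultiplication.OmegaCensus.ThreeSetZ17Cells446Core
import Summits.MatrixMultiplication.OmegaCensus.ThreeSetZ17Killers446Join
import HarnessLib

/-!
# The census cell `(4,4,6)@289` is KERNEL: no cube law triple with parts `4, 4, 6` in `Dih(ℤ₁₇²)`

ω-census `pub-omega`, family (b3), seat pub-omega-group gen 39.  Framing: lottery ticket; floor = certified bounds/negative ranges.
VALUE: a kernel theorem about the group-theoretic method (TPP capacity of dihedral-like groups); NOT progress on ω.  Census: the
three-set cell `(4,4,6)` at `|A| = 289` (`A = ℤ₁₇²`), hitherto ENGINE ×3 by one reduction (NR74: '1 487 415 systems ⇒ 88 672 pairs /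
1 972 w; census 272 viable W-nodes, 0 W admissible in all 18 directions'), is KERNEL — by a W-LEVEL certificate: every frame
`{0, e₁, e₂, c}` has a line whose `W`-datum is one of four KILLERS (`ThreeSetZ17Cover446`), and each killer admits no `(X, Y, s)` solving
the three-set line identity (`ThreeSetZ17Killers446*`, `4 × 4845` in-kernel inverse certificates `LineInv.noSol3Chk`,
`ThreeSetLineInverseCertificate`).  With it ORDER 289 becomes ONE kernel theorem (`DihedralLawModOneOrder289`).
* `no_cube_form_44_card289`, `no_law_cube_446_card289`, `no_law_cube_four_four_card289` (any `A` with `|A| = 289`, `A ↠ ℤ₁₇²`;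
  dihedral-like `G`, any `c₀`), `no_law_cube_four_four_z17_z17`.
-/

namespace Summit.MatrixMultiplication.OmegaCensus

open Finset ZpZpDomino

section Core

variable {A : Type*} [AddCommGroup A] [Fintype A] [DecidableEq A]

/-- **No three-set cube symmetric form with `|W| = |X| = 4`, `|Y| = 6` over `|A| = 289`, `A ↠ ℤ₁₇²`.** [folklore] -/
theorem no_cube_form_44_card289 (hA : Fintype.card A = 289) (Φ : A →+ ZMod 17 × ZMod 17)
    (hΦ : Function.Surjective Φ) {W X Y : Finset A} {x₀ : A} (hW : W.card = 4) (hX : X.card = 4) (hY : Y.card = 6)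
    (h₁ : Set.InjOn (fun p : A × A × A => -p.1 + p.2.1 + p.2.2) ↑(W ×ˢ X ×ˢ Y))
    (h₂ : Set.InjOn (fun p : A × A × A => p.1 - p.2.1 + p.2.2) ↑(W ×ˢ X ×ˢ Y))
    (h₃ : Set.InjOn (fun p : A × A × A => p.1 + p.2.1 - p.2.2) ↑(W ×ˢ X ×ˢ Y))
    (d₁₂ : Disjoint ((W ×ˢ X ×ˢ Y).image fun p : A × A × A => -p.1 + p.2.1 + p.2.2)
      ((W ×ˢ X ×ˢ Y).image fun p : A × A × A => p.1 - p.2.1 + p.2.2))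
    (d₁₃ : Disjoint ((W ×ˢ X ×ˢ Y).image fun p : A × A × A => -p.1 + p.2.1 + p.2.2)
      ((W ×ˢ X ×ˢ Y).image fun p : A × A × A => p.1 + p.2.1 - p.2.2))
    (d₂₃ : Disjoint ((W ×ˢ X ×ˢ Y).image fun p : A × A × A => p.1 - p.2.1 + p.2.2)
      ((W ×ˢ X ×ˢ Y).image fun p : A × A × A => p.1 + p.2.1 - p.2.2))
    (hcover : ((W ×ˢ X ×ˢ Y).image fun p : A × A × A => -p.1 + p.2.1 + p.2.2) ∪
      ((W ×ˢ X ×ˢ Y).image fun p : A × A × A => p.1 - p.2.1 + p.2.2) ∪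
      ((W ×ˢ X ×ˢ Y).image fun p : A × A × A => p.1 + p.2.1 - p.2.2) = univ.erase x₀) : False :=
  no_cube_form_44_card289_of_killers Z17Killers446.killers446 hA Φ hΦ hW hX hY h₁ h₂ h₃ d₁₂ d₁₃ d₂₃ hcover

end Core

section DihedralLike

variable {A : Type} [AddCommGroup A] [DecidableEq A] [Fintype A] {G : Type} [Group G] [DecidableEq G]
  {ρ τ : A → G} {c₀ : A} {S T U : Finset G}

open Literature.Combinatorics.Additive

/-- **No `(4,4 | 4,4 | 6,6)` law triple over `|A| = 289`, `A ↠ ℤ₁₇²`** (dihedral-like `G`, any `c₀`). [folklore] -/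
theorem no_law_cube_446_card289 (hA : Fintype.card A = 289)
    (hρρ : ∀ a b, ρ a * ρ b = ρ (a + b)) (hρτ : ∀ a b, ρ a * τ b = τ (b - a))
    (hτρ : ∀ a b, τ a * ρ b = τ (a + b)) (hττ : ∀ a b, τ a * τ b = ρ (c₀ + b - a))
    (hρ : Function.Injective ρ) (hτ : Function.Injective τ) (hne : ∀ a b, ρ a ≠ τ b)
    (hsurj : ∀ g, (∃ a, ρ a = g) ∨ (∃ a, τ a = g))
    (Φ : A →+ ZMod 17 × ZMod 17) (hΦ : Function.Surjective Φ)
    (h : TripleProductProperty S T U)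
    (hS₀ : (univ.filter fun a : A => ρ a ∈ S).card = 4) (hS₁ : (univ.filter fun a : A => τ a ∈ S).card = 4)
    (hT₀ : (univ.filter fun a : A => ρ a ∈ T).card = 4) (hT₁ : (univ.filter fun a : A => τ a ∈ T).card = 4)
    (hU : (univ.filter fun a : A => ρ a ∈ U).card = (univ.filter fun a : A => τ a ∈ U).card)
    (hV : 3 * (S.card * T.card * U.card) + 8 = 8 * Fintype.card A) : False :=
  no_law_cube_446_card289_of_killers Z17Killers446.killers446 hA hρρ hρτ hτρ hττ hρ hτ hne hsurj Φ hΦ h hS₀ hS₁ hT₀ hT₁ hU hV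

/-- **Cell `(4,4,6)@289` in all orderings**: balanced coset parts with two parts `4` ⇒ `3|S||T||U| + 8 ≠ 8|A|` over `|A| = 289`,
`A ↠ ℤ₁₇²` (dihedral-like `G`, any `c₀`). [folklore] -/
theorem no_law_cube_four_four_card289 (hA : Fintype.card A = 289)
    (hρρ : ∀ a b, ρ a * ρ b = ρ (a + b)) (hρτ : ∀ a b, ρ a * τ b = τ (b - a))
    (hτρ : ∀ a b, τ a * ρ b = τ (a + b)) (hττ : ∀ a b, τ a * τ b = ρ (c₀ + b - a))
    (hρ : Function.Injective ρ) (hτ : Function.Injective τ) (hne : ∀ a b, ρ a ≠ τ b)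
    (hsurj : ∀ g, (∃ a, ρ a = g) ∨ (∃ a, τ a = g))
    (Φ : A →+ ZMod 17 × ZMod 17) (hΦ : Function.Surjective Φ)
    (h : TripleProductProperty S T U)
    (hS : (univ.filter fun a : A => ρ a ∈ S).card = (univ.filter fun a : A => τ a ∈ S).card)
    (hT : (univ.filter fun a : A => ρ a ∈ T).card = (univ.filter fun a : A => τ a ∈ T).card)
    (hU : (univ.filter fun a : A => ρ a ∈ U).card = (univ.filter fun a : A => τ a ∈ U).card)
    (h44 : ((univ.filter fun a : A => ρ a ∈ S).card = 4 ∧ (univ.filter fun a : A => ρ a ∈ T).card = 4) ∨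
      ((univ.filter fun a : A => ρ a ∈ T).card = 4 ∧ (univ.filter fun a : A => ρ a ∈ U).card = 4) ∨
      ((univ.filter fun a : A => ρ a ∈ U).card = 4 ∧ (univ.filter fun a : A => ρ a ∈ S).card = 4)) :
    3 * (S.card * T.card * U.card) + 8 ≠ 8 * Fintype.card A :=
  no_law_cube_four_four_card289_of_killers Z17Killers446.killers446 hA hρρ hρτ hτρ hττ hρ hτ hne hsurj Φ hΦ h hS hT hU h44

end DihedralLike

section Instance

variable {G : Type} [Group G] [DecidableEq G] {S T U : Finset G}

open Literature.Combinatorics.Additive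

/-- **`Dih(ℤ₁₇ × ℤ₁₇)`: no TPP triple with balanced coset parts and two parts `4` attains the law** (the census cell `(4,4,6)@289`).
[folklore] -/
theorem no_law_cube_four_four_z17_z17 {ρ τ : ZMod 17 × ZMod 17 → G} {c₀ : ZMod 17 × ZMod 17}
    (hρρ : ∀ a b, ρ a * ρ b = ρ (a + b)) (hρτ : ∀ a b, ρ a * τ b = τ (b - a))
    (hτρ : ∀ a b, τ a * ρ b = τ (a + b)) (hττ : ∀ a b, τ a * τ b = ρ (c₀ + b - a))
    (hρ : Function.Injective ρ) (hτ : Function.Injective τ) (hne : ∀ a b, ρ a ≠ τ b)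
    (hsurj : ∀ g, (∃ a, ρ a = g) ∨ (∃ a, τ a = g))
    (h : TripleProductProperty S T U)
    (hS : (univ.filter fun a : ZMod 17 × ZMod 17 => ρ a ∈ S).card = (univ.filter fun a : ZMod 17 × ZMod 17 => τ a ∈ S).card)
    (hT : (univ.filter fun a : ZMod 17 × ZMod 17 => ρ a ∈ T).card = (univ.filter fun a : ZMod 17 × ZMod 17 => τ a ∈ T).card)
    (hU : (univ.filter fun a : ZMod 17 × ZMod 17 => ρ a ∈ U).card = (univ.filter fun a : ZMod 17 × ZMod 17 => τ a ∈ U).card)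
    (h44 : ((univ.filter fun a : ZMod 17 × ZMod 17 => ρ a ∈ S).card = 4 ∧
        (univ.filter fun a : ZMod 17 × ZMod 17 => ρ a ∈ T).card = 4) ∨
      ((univ.filter fun a : ZMod 17 × ZMod 17 => ρ a ∈ T).card = 4 ∧
        (univ.filter fun a : ZMod 17 × ZMod 17 => ρ a ∈ U).card = 4) ∨
      ((univ.filter fun a : ZMod 17 × ZMod 17 => ρ a ∈ U).card = 4 ∧
        (univ.filter fun a : ZMod 17 × ZMod 17 => ρ a ∈ S).card = 4)) :
    3 * (S.card * T.card * U.card) + 8 ≠ 8 * Fintype.card (ZMod 17 × ZMod 17) :=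
  no_law_cube_four_four_card289 (by simp [Fintype.card_prod, ZMod.card]) hρρ hρτ hτρ hττ hρ hτ hne hsurj (AddMonoidHom.id _)
    (fun q => ⟨q, rfl⟩) h hS hT hU h44

end Instance

end Summit.MatrixMultiplication.OmegaCensus
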